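import Mathlib

/-!
# The `3 × 3 × 3` permutation pattern is not a sum of two slices

Route `ValiantsHypothesis/RigidityForcesSymmetry`, crux `RankRigidMinimalRepr` (stmt-ValiantsHypothesis-18034): the finite
tensor lemma «W(3)» behind the level count for THREE tied columns (sequel of the stub `stub_levelBound`, which is the case
of two tied columns and rests on «W(2)»: `[[0,1],[1,0]]` is not of rank `≤ 1`).

Let `x₀, x₁, x₂` be three distinct points of a type `X` and `J : X → X → X → ℂ` a function with the PERMUTATION PATTERN on
them: for `a, b, c ∈ {x₀, x₁, x₂}`, `J a b c = 1` if `a, b, c` are pairwise distinct and `0` otherwise (the coefficient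
tensor of `perm_3`).  A SLICE along the first position is a function `(a, b, c) ↦ f a · G b c`, along the second
`(a, b, c) ↦ g b · H a c`, along the third `(a, b, c) ↦ h c · K a b`.

* `permPattern_three_not_two_slices_same` — `J` is not a sum of two slices along the first position (on the `27` pattern
  points): the three rows `a = x₀, x₁, x₂` of `J` would lie in the span of `G₁, G₂`, but they have disjoint non-empty
  supports (certificate: a `3 × 3` determinant that vanishes identically by Cauchy–Binet yet evaluates to `det 1 = 1`).
* `permPattern_three_not_two_slices_mixed` — `J` is not a sum of a slice along the first and a slice along the second
  position: the slice `b = x₂` of `J` (an anti-diagonal `2 × 2` pattern) forces `g x₂ ≠ 0`; the diagonal `b = c` gives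
  `g c · H a c = -f a · G c c`, whence `g x₂ · J a b x₂ = f a · (G b x₂ g x₂ - g b G x₂ x₂)` would have rank `≤ 1` in
  `(a, b)`, which the values `J x₀ x₁ x₂ = J x₁ x₀ x₂ = 1`, `J x₁ x₁ x₂ = 0` refute.
All other position pairs reduce to these two by permuting the arguments of `J` (the pattern is symmetric), see
`permPattern_three_not_two_slices`.  Equivalently: the permutation tensor `P_3 ∈ (ℂ³)^{⊗3}` has slice rank (indeed partition
rank) exactly `3`.

HONEST FRAMING: an elementary finite lemma (no literature claim beyond folklore slice-rank reasoning); it is the input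
«W(3)» of the block count for three tied columns; nothing here bears on `VP ≠ VNP`.
-/

set_option autoImplicit false

-- the mandated summit-side namespace repeats a component by design (single-problem summit)
set_option linter.dupNamespace false

namespace Summit.ValiantsHypothesis.ValiantsHypothesis.Theorems.RigidityForcesSymmetryRankRigidMinimalRepr

variable {X : Type*} [DecidableEq X]

/-- **Two slices along the same position do not give the permutation pattern.**  If `J` has the permutation
pattern on three distinct points `x₀, x₁, x₂` then `J a b c = f₁ a · G₁ b c + f₂ a · G₂ b c` cannot hold at all pattern
points. -/
theorem permPattern_three_not_two_slices_same {x₀ x₁ x₂ : X} (h01 : x₀ ≠ x₁) (h02 : x₀ ≠ x₂) (h12 : x₁ ≠ x₂)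
    (J : X → X → X → ℂ)
    (hJ : ∀ a ∈ ({x₀, x₁, x₂} : Finset X), ∀ b ∈ ({x₀, x₁, x₂} : Finset X), ∀ c ∈ ({x₀, x₁, x₂} : Finset X),
      J a b c = if a ≠ b ∧ a ≠ c ∧ b ≠ c then 1 else 0)
    (f₁ f₂ : X → ℂ) (G₁ G₂ : X → X → ℂ)
    (h : ∀ a ∈ ({x₀, x₁, x₂} : Finset X), ∀ b ∈ ({x₀, x₁, x₂} : Finset X), ∀ c ∈ ({x₀, x₁, x₂} : Finset X),
      J a b c = f₁ a * G₁ b c + f₂ a * G₂ b c) : False := by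
  have m0 : x₀ ∈ ({x₀, x₁, x₂} : Finset X) := by simp
  have m1 : x₁ ∈ ({x₀, x₁, x₂} : Finset X) := by simp
  have m2 : x₂ ∈ ({x₀, x₁, x₂} : Finset X) := by simp
  -- the nine values `J a (column)` for the columns `(x₁,x₂), (x₀,x₂), (x₀,x₁)`: the identity matrix
  have v : ∀ a ∈ ({x₀, x₁, x₂} : Finset X), ∀ b ∈ ({x₀, x₁, x₂} : Finset X), ∀ c ∈ ({x₀, x₁, x₂} : Finset X),
      f₁ a * G₁ b c + f₂ a * G₂ b c = if a ≠ b ∧ a ≠ c ∧ b ≠ c then 1 else 0 :=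
    fun a ha b hb c hc => (h a ha b hb c hc).symm.trans (hJ a ha b hb c hc)
  have e1 := v x₀ m0 x₁ m1 x₂ m2
  have e2 := v x₀ m0 x₀ m0 x₂ m2
  have e3 := v x₀ m0 x₀ m0 x₁ m1
  have e4 := v x₁ m1 x₁ m1 x₂ m2
  have e5 := v x₁ m1 x₀ m0 x₂ m2
  have e6 := v x₁ m1 x₀ m0 x₁ m1
  have e7 := v x₂ m2 x₁ m1 x₂ m2
  have e8 := v x₂ m2 x₀ m0 x₂ m2
  have e9 := v x₂ m2 x₀ m0 x₁ m1
  simp only [ne_eq, h01, h02, h12, h01.symm, h02.symm, h12.symm, not_false_eq_true, not_true_eq_false,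
    and_true, and_false, and_self, if_true, if_false] at e1 e2 e3 e4 e5 e6 e7 e8 e9
  -- Cauchy–Binet: the determinant of a `3 × 3` matrix of rank `≤ 2` vanishes identically
  have key : (f₁ x₀ * G₁ x₁ x₂ + f₂ x₀ * G₂ x₁ x₂) *
        ((f₁ x₁ * G₁ x₀ x₂ + f₂ x₁ * G₂ x₀ x₂) * (f₁ x₂ * G₁ x₀ x₁ + f₂ x₂ * G₂ x₀ x₁) -
          (f₁ x₁ * G₁ x₀ x₁ + f₂ x₁ * G₂ x₀ x₁) * (f₁ x₂ * G₁ x₀ x₂ + f₂ x₂ * G₂ x₀ x₂)) -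
      (f₁ x₀ * G₁ x₀ x₂ + f₂ x₀ * G₂ x₀ x₂) *
        ((f₁ x₁ * G₁ x₁ x₂ + f₂ x₁ * G₂ x₁ x₂) * (f₁ x₂ * G₁ x₀ x₁ + f₂ x₂ * G₂ x₀ x₁) -
          (f₁ x₁ * G₁ x₀ x₁ + f₂ x₁ * G₂ x₀ x₁) * (f₁ x₂ * G₁ x₁ x₂ + f₂ x₂ * G₂ x₁ x₂)) +
      (f₁ x₀ * G₁ x₀ x₁ + f₂ x₀ * G₂ x₀ x₁) *
        ((f₁ x₁ * G₁ x₁ x₂ + f₂ x₁ * G₂ x₁ x₂) * (f₁ x₂ * G₁ x₀ x₂ + f₂ x₂ * G₂ x₀ x₂) -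
          (f₁ x₁ * G₁ x₀ x₂ + f₂ x₁ * G₂ x₀ x₂) * (f₁ x₂ * G₁ x₁ x₂ + f₂ x₂ * G₂ x₁ x₂)) = 0 := by
    ring
  rw [e1, e2, e3, e4, e5, e6, e7, e8, e9] at key
  norm_num at key

/-- **A slice along the first and a slice along the second position do not give the permutation pattern.** -/
theorem permPattern_three_not_two_slices_mixed {x₀ x₁ x₂ : X} (h01 : x₀ ≠ x₁) (h02 : x₀ ≠ x₂) (h12 : x₁ ≠ x₂)
    (J : X → X → X → ℂ)
    (hJ : ∀ a ∈ ({x₀, x₁, x₂} : Finset X), ∀ b ∈ ({x₀, x₁, x₂} : Finset X), ∀ c ∈ ({x₀, x₁, x₂} : Finset X),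
      J a b c = if a ≠ b ∧ a ≠ c ∧ b ≠ c then 1 else 0)
    (f g : X → ℂ) (G H : X → X → ℂ)
    (h : ∀ a ∈ ({x₀, x₁, x₂} : Finset X), ∀ b ∈ ({x₀, x₁, x₂} : Finset X), ∀ c ∈ ({x₀, x₁, x₂} : Finset X),
      J a b c = f a * G b c + g b * H a c) : False := by
  have m0 : x₀ ∈ ({x₀, x₁, x₂} : Finset X) := by simp
  have m1 : x₁ ∈ ({x₀, x₁, x₂} : Finset X) := by simp
  have m2 : x₂ ∈ ({x₀, x₁, x₂} : Finset X) := by simp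
  have v : ∀ a ∈ ({x₀, x₁, x₂} : Finset X), ∀ b ∈ ({x₀, x₁, x₂} : Finset X), ∀ c ∈ ({x₀, x₁, x₂} : Finset X),
      f a * G b c + g b * H a c = if a ≠ b ∧ a ≠ c ∧ b ≠ c then 1 else 0 :=
    fun a ha b hb c hc => (h a ha b hb c hc).symm.trans (hJ a ha b hb c hc)
  -- slice `b = x₂`: an anti-diagonal pattern in `(a, c) ∈ {x₀, x₁}²`
  have s1 := v x₀ m0 x₂ m2 x₁ m1
  have s2 := v x₁ m1 x₂ m2 x₀ m0
  have s3 := v x₀ m0 x₂ m2 x₀ m0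
  -- diagonal `b = c = x₂` and the three values `J x₀ x₁ x₂`, `J x₁ x₁ x₂`, `J x₁ x₀ x₂`
  have d0 := v x₀ m0 x₂ m2 x₂ m2
  have d1 := v x₁ m1 x₂ m2 x₂ m2
  have t1 := v x₀ m0 x₁ m1 x₂ m2
  have t2 := v x₁ m1 x₁ m1 x₂ m2
  have t3 := v x₁ m1 x₀ m0 x₂ m2
  simp only [ne_eq, h01, h02, h12, h01.symm, h02.symm, h12.symm, not_false_eq_true, not_true_eq_false,
    and_true, and_false, and_self, if_true, if_false] at s1 s2 s3 d0 d1 t1 t2 t3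
  by_cases hg : g x₂ = 0
  · -- then the slice `b = x₂` of `J` would be the rank-one `f a · G x₂ c`
    rw [hg, zero_mul, add_zero] at s1 s2 s3
    have : (f x₀ * G x₂ x₀) * (f x₁ * G x₂ x₁) = (f x₀ * G x₂ x₁) * (f x₁ * G x₂ x₀) := by ring
    rw [s1, s2, s3] at this
    norm_num at this
  · -- `g x₂ · J a b x₂ = f a · K b` with `K b = G b x₂ · g x₂ - g b · G x₂ x₂`
    have k1 : f x₁ * (G x₁ x₂ * g x₂ - g x₁ * G x₂ x₂) = 0 := by
      linear_combination g x₂ * t2 - g x₁ * d1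
    have k2 : f x₁ * (G x₀ x₂ * g x₂ - g x₀ * G x₂ x₂) = g x₂ := by
      linear_combination g x₂ * t3 - g x₀ * d1
    have k3 : f x₀ * (G x₁ x₂ * g x₂ - g x₁ * G x₂ x₂) = g x₂ := by
      linear_combination g x₂ * t1 - g x₁ * d0
    rcases mul_eq_zero.1 k1 with hf | hK
    · rw [hf, zero_mul] at k2
      exact hg k2.symm
    · rw [hK, mul_zero] at k3
      exact hg k3.symm

/-- **`W(3)`: the permutation pattern on three points is not a sum of two slices**, along any two positions
`i, j ∈ {first, second, third}` (nine cases, reduced to the two above by permuting the arguments of `J`).  A slice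
along position `i` is given as a function `S` with `S a b c = φ (argument i) · Ψ (the other two arguments)`. -/
theorem permPattern_three_not_two_slices {x₀ x₁ x₂ : X} (h01 : x₀ ≠ x₁) (h02 : x₀ ≠ x₂) (h12 : x₁ ≠ x₂)
    (J : X → X → X → ℂ)
    (hJ : ∀ a ∈ ({x₀, x₁, x₂} : Finset X), ∀ b ∈ ({x₀, x₁, x₂} : Finset X), ∀ c ∈ ({x₀, x₁, x₂} : Finset X),
      J a b c = if a ≠ b ∧ a ≠ c ∧ b ≠ c then 1 else 0)
    (i j : Fin 3) (S₁ S₂ : X → X → X → ℂ)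
    (hS₁ : ∃ φ : X → ℂ, ∃ Ψ : X → X → ℂ, ∀ a b c,
      S₁ a b c = (if i = 0 then φ a * Ψ b c else if i = 1 then φ b * Ψ a c else φ c * Ψ a b))
    (hS₂ : ∃ φ : X → ℂ, ∃ Ψ : X → X → ℂ, ∀ a b c,
      S₂ a b c = (if j = 0 then φ a * Ψ b c else if j = 1 then φ b * Ψ a c else φ c * Ψ a b))
    (h : ∀ a ∈ ({x₀, x₁, x₂} : Finset X), ∀ b ∈ ({x₀, x₁, x₂} : Finset X), ∀ c ∈ ({x₀, x₁, x₂} : Finset X),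
      J a b c = S₁ a b c + S₂ a b c) : False := by
  obtain ⟨φ₁, Ψ₁, e₁⟩ := hS₁
  obtain ⟨φ₂, Ψ₂, e₂⟩ := hS₂
  -- the pattern is symmetric in its three arguments
  have hJ' : ∀ a ∈ ({x₀, x₁, x₂} : Finset X), ∀ b ∈ ({x₀, x₁, x₂} : Finset X), ∀ c ∈ ({x₀, x₁, x₂} : Finset X),
      (J b a c = if a ≠ b ∧ a ≠ c ∧ b ≠ c then 1 else 0) ∧
      (J b c a = if a ≠ b ∧ a ≠ c ∧ b ≠ c then 1 else 0) ∧
      (J a c b = if a ≠ b ∧ a ≠ c ∧ b ≠ c then 1 else 0) ∧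
      (J c a b = if a ≠ b ∧ a ≠ c ∧ b ≠ c then 1 else 0) := by
    intro a ha b hb c hc
    refine ⟨?_, ?_, ?_, ?_⟩
    · rw [hJ b hb a ha c hc]
      exact if_congr ⟨fun h => ⟨Ne.symm h.1, h.2.2, h.2.1⟩, fun h => ⟨Ne.symm h.1, h.2.2, h.2.1⟩⟩ rfl rfl
    · rw [hJ b hb c hc a ha]
      exact if_congr ⟨fun h => ⟨Ne.symm h.2.1, Ne.symm h.2.2, h.1⟩, fun h => ⟨h.2.2, Ne.symm h.1, Ne.symm h.2.1⟩⟩ rfl rfl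
    · rw [hJ a ha c hc b hb]
      exact if_congr ⟨fun h => ⟨h.2.1, h.1, Ne.symm h.2.2⟩, fun h => ⟨h.2.1, h.1, Ne.symm h.2.2⟩⟩ rfl rfl
    · rw [hJ c hc a ha b hb]
      exact if_congr ⟨fun h => ⟨h.2.2, Ne.symm h.1, Ne.symm h.2.1⟩, fun h => ⟨Ne.symm h.2.1, Ne.symm h.2.2, h.1⟩⟩ rfl rfl
  fin_cases i <;> fin_cases j <;>
    simp only [Fin.zero_eta, Fin.mk_one, Fin.reduceFinMk, Fin.isValue, if_true, if_false,
      one_ne_zero, Fin.reduceEq] at e₁ e₂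
  · -- (first, first)
    exact permPattern_three_not_two_slices_same h01 h02 h12 J hJ φ₁ φ₂ Ψ₁ Ψ₂
      fun a ha b hb c hc => by rw [h a ha b hb c hc, e₁, e₂]
  · -- (first, second)
    exact permPattern_three_not_two_slices_mixed h01 h02 h12 J hJ φ₁ φ₂ Ψ₁ (fun a c => Ψ₂ a c)
      fun a ha b hb c hc => by rw [h a ha b hb c hc, e₁, e₂]
  · -- (first, third): swap the last two arguments
    exact permPattern_three_not_two_slices_mixed h01 h02 h12 (fun a b c => J a c b)
      (fun a ha b hb c hc => (hJ' a ha b hb c hc).2.2.1) φ₁ φ₂ (fun b c => Ψ₁ c b) (fun a c => Ψ₂ a c)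
      fun a ha b hb c hc => by rw [h a ha c hc b hb, e₁, e₂]
  · -- (second, first): swap the two slices
    exact permPattern_three_not_two_slices_mixed h01 h02 h12 J hJ φ₂ φ₁ Ψ₂ (fun a c => Ψ₁ a c)
      fun a ha b hb c hc => by rw [h a ha b hb c hc, e₁, e₂, add_comm]
  · -- (second, second): swap the first two arguments
    exact permPattern_three_not_two_slices_same h01 h02 h12 (fun a b c => J b a c)
      (fun a ha b hb c hc => (hJ' a ha b hb c hc).1) φ₁ φ₂ (fun b c => Ψ₁ b c) (fun b c => Ψ₂ b c)
      fun a ha b hb c hc => by rw [h b hb a ha c hc, e₁, e₂]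
  · -- (second, third): cycle the arguments `(a, b, c) ↦ J c a b`
    exact permPattern_three_not_two_slices_mixed h01 h02 h12 (fun a b c => J c a b)
      (fun a ha b hb c hc => (hJ' a ha b hb c hc).2.2.2) φ₁ φ₂ (fun b c => Ψ₁ c b) (fun a c => Ψ₂ c a)
      fun a ha b hb c hc => by rw [h c hc a ha b hb, e₁, e₂]
  · -- (third, first)
    exact permPattern_three_not_two_slices_mixed h01 h02 h12 (fun a b c => J a c b)
      (fun a ha b hb c hc => (hJ' a ha b hb c hc).2.2.1) φ₂ φ₁ (fun b c => Ψ₂ c b) (fun a c => Ψ₁ a c)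
      fun a ha b hb c hc => by rw [h a ha c hc b hb, e₁, e₂, add_comm]
  · -- (third, second)
    exact permPattern_three_not_two_slices_mixed h01 h02 h12 (fun a b c => J c a b)
      (fun a ha b hb c hc => (hJ' a ha b hb c hc).2.2.2) φ₂ φ₁ (fun b c => Ψ₂ c b) (fun a c => Ψ₁ c a)
      fun a ha b hb c hc => by rw [h c hc a ha b hb, e₁, e₂, add_comm]
  · -- (third, third): cycle `(a, b, c) ↦ J b c a`
    exact permPattern_three_not_two_slices_same h01 h02 h12 (fun a b c => J b c a)
      (fun a ha b hb c hc => (hJ' a ha b hb c hc).2.1) φ₁ φ₂ (fun b c => Ψ₁ b c) (fun b c => Ψ₂ b c)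
      fun a ha b hb c hc => by rw [h b hb c hc a ha, e₁, e₂]

end Summit.ValiantsHypothesis.ValiantsHypothesis.Theorems.RigidityForcesSymmetryRankRigidMinimalRepr
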